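import Summits.Ventures.LatticeQCDFlow.Scaling.PlaquetteMarginals2D
import Summits.Ventures.LatticeQCDFlow.Scaling.TopologicalCollar
import Summits.Ventures.LatticeQCDFlow.Scoring.RealConvolutionPowers
import Literature.MathematicalPhysics.QuantumFieldTheory.LatticeGaugeProofs
import HarnessLib

/-!
# Topological sectors of two-dimensional `U(1)` on the torus, I: sector weights and the sector integrand

HONEST FRAMING: exact (Metropolis-corrected) sampling algorithms for lattice gauge theory;
figures of merit are autocorrelation/cost numbers at stated couplings and volumes; no
continuum-physics claim.

Venture `LatticeQCDFlow` (cell pub-lqcd), sub-topic `Scoring`; FANOUT row 5 (`s0-sun-a`), GEN-8.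
NEW WORK of the cell (placement rule); part 1 of 2 of the kernel-level derivation of the exact
TOPOLOGICAL-CHARGE LAW of 2-d compact `U(1)` — the formula behind the sector weights
`pi_k = g_V(2πk) / Σ_j g_V(2πj)` of the cell's exact oracle (`ref-exact` `ORACLE-u1-2d.json`:
"`g_V` = `V`-fold convolution of `p(θ) ∝ exp(β cos θ)`", "`Q = (1/2π) Σ_P θ_P`, `θ_P ∈ (−π, π]`"),
for the objects the cell's theory files use: the Wilson measure `wilsonMeasure u1Rep β` of
`U(1) = Circle` on `Λ = (ℤ/L)²` (`Literature…ConstructiveQFTWave0`, plaquette action `1 − Re U_p`)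
and theory-2's `topCharge U = (2π)⁻¹ Σ_x arg U_p(x)` (`Scaling/TopologicalCollar.lean`).

This file:
* §1 the one-plaquette angular weight `p_β = e^{−β(1−cos φ)} 1_{[−π,π]}` (`u1AngleWeight`; even,
  bounded, a.e. equal to its half-open variant `u1AngleWeightIoc`) and the SECTOR WEIGHTS
  `u1SectorWeight β V k = g_V(2πk) = p_β^{*V}(2πk)` (`Scoring/RealConvolutionPowers.lean`; even in
  `k`, finite, an honest `(V−1)`-fold integral `u1SectorWeight_eq_lintegral`);
* §2 `topCharge_eq_sum_arg`: `Q(U) = (2π)⁻¹ Σ_{x ∈ Λ} arg U_x`, `topCharge_eq_iff`;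
* §3 the SECTOR INTEGRAND `F_k(g) = 1{Σ_x arg g_x = 2πk} ∏_x e^{−β(1 − Re g_x)}` on plaquette fields
  `g : Λ → U(1)`, its version `F'_k` with one coordinate eliminated by `g_{x₀} = (∏_{x≠x₀} g_x)⁻¹`,
  `wilsonWeight_topCharge_eq_lintegral` (`∫_{Q=k} e^{−βS} = ∫ F_k(U_·)`) and the PUNCTURE step
  `lintegral_sectorIntegrand_eq_pi` (`= ∫_{U(1)^Λ} F'_k dHaar^{⊗Λ}`, by theory-2's independence of the
  plaquettes off `x₀`, `Scaling/PlaquetteMarginals2D.lean`).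

Part 2 (`Scoring/U1TorusTopologicalChargeLaw.lean`) passes to angles and proves the law.
References for the classical formula: C. Bonati, P. Rossi, Phys. Rev. D 99 (2019) 054503;
M. Hirasawa, A. Matsumoto, J. Nishimura, A. Yosprakob, JHEP 09 (2020) 023 [arXiv:2004.13982] §7.
-/

noncomputable section

open MeasureTheory Set Real
open scoped ENNReal
open Literature.MathematicalPhysics.QuantumFieldTheory
open Literature.MathematicalPhysics.QuantumLattice (u1Rep u1Rep_apply continuous_u1Rep magneticFlux
  abelianFieldTensor circleExp_finset_sum)
open Summit.Ventures.LatticeQCDFlow.Theory2.Lattice (topCharge exists_int_eq_topCharge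
  measurable_topCharge)
open Summit.Ventures.LatticeQCDFlow.Theory2.Lattice.TwoDim

namespace Summit.Ventures.LatticeQCDFlow.Scoring

/-! ### 1. The one-plaquette angular weight and the sector weights -/

/-- The one-plaquette weight of 2-d `U(1)` in the angle, on ONE period:
`p_β(φ) = e^{−β(1 − cos φ)} · 1_{[−π, π]}(φ)` (the tree's plaquette action `1 − Re U_p`; the
oracle's `p(θ) ∝ e^{β cos θ}` up to the constant `e^{−β}`). -/
def u1AngleWeight (β : ℝ) : ℝ → ℝ≥0∞ :=
  (Icc (-π) π).indicator fun φ => ENNReal.ofReal (Real.exp (-(β * (1 - Real.cos φ))))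

/-- The half-open variant `e^{−β(1 − cos φ)} · 1_{(−π, π]}(φ)` (the form the angle
parametrisation of Haar measure produces; a.e. equal to `u1AngleWeight`). -/
def u1AngleWeightIoc (β : ℝ) : ℝ → ℝ≥0∞ :=
  (Ioc (-π) π).indicator fun φ => ENNReal.ofReal (Real.exp (-(β * (1 - Real.cos φ))))

/-- **The sector weight** `g_V(2πk) = p_β^{*V}(2πk)`: the `V`-fold real-line convolution power of
the one-plaquette weight, evaluated at `2πk` (`V ≥ 1`; for `V = 0` the junk value `p_β(2πk)`). -/
def u1SectorWeight (β : ℝ) (V : ℕ) (k : ℤ) : ℝ≥0∞ :=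
  convPow (u1AngleWeight β) (V - 1) (2 * π * k)

variable (β : ℝ)

/-- `p_β` is measurable. -/
theorem measurable_u1AngleWeight : Measurable (u1AngleWeight β) := by
  unfold u1AngleWeight
  exact (Measurable.ennreal_ofReal (by fun_prop)).indicator measurableSet_Icc

/-- The half-open variant is measurable. -/
theorem measurable_u1AngleWeightIoc : Measurable (u1AngleWeightIoc β) := by
  unfold u1AngleWeightIoc
  exact (Measurable.ennreal_ofReal (by fun_prop)).indicator measurableSet_Ioc

/-- `p_β` is even. -/
theorem u1AngleWeight_neg (φ : ℝ) : u1AngleWeight β (-φ) = u1AngleWeight β φ := by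
  unfold u1AngleWeight
  by_cases h : φ ∈ Icc (-π) π
  · have h' : -φ ∈ Icc (-π) π := ⟨by linarith [h.2], by linarith [h.1]⟩
    rw [indicator_of_mem h, indicator_of_mem h', Real.cos_neg]
  · have h' : -φ ∉ Icc (-π) π := fun h' => h ⟨by linarith [h'.2], by linarith [h'.1]⟩
    rw [indicator_of_notMem h, indicator_of_notMem h']

/-- `p_β ≤ e^{|β|·2}` pointwise. -/
theorem u1AngleWeight_le (φ : ℝ) : u1AngleWeight β φ ≤ ENNReal.ofReal (Real.exp (|β| * 2)) := by
  unfold u1AngleWeight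
  refine (indicator_le_self _ _ φ).trans (ENNReal.ofReal_le_ofReal (Real.exp_le_exp.2 ?_))
  have h1 : 0 ≤ 1 - Real.cos φ := by linarith [Real.cos_le_one φ]
  have h2 : 1 - Real.cos φ ≤ 2 := by linarith [Real.neg_one_le_cos φ]
  calc -(β * (1 - Real.cos φ)) ≤ |β * (1 - Real.cos φ)| := neg_le_abs _
    _ = |β| * (1 - Real.cos φ) := by rw [abs_mul, abs_of_nonneg h1]
    _ ≤ |β| * 2 := mul_le_mul_of_nonneg_left h2 (abs_nonneg _)

/-- `∫ p_β ≤ e^{2|β|} · 2π < ∞`. -/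
theorem lintegral_u1AngleWeight_le :
    ∫⁻ φ, u1AngleWeight β φ ≤ ENNReal.ofReal (Real.exp (|β| * 2)) * ENNReal.ofReal (2 * π) := by
  have h : ∀ φ, u1AngleWeight β φ ≤
      (Icc (-π) π).indicator (fun _ => ENNReal.ofReal (Real.exp (|β| * 2))) φ := by
    intro φ
    by_cases hφ : φ ∈ Icc (-π) π
    · rw [indicator_of_mem hφ]; exact u1AngleWeight_le β φ
    · unfold u1AngleWeight; rw [indicator_of_notMem hφ, indicator_of_notMem hφ]
  calc ∫⁻ φ, u1AngleWeight β φ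
      ≤ ∫⁻ φ, (Icc (-π) π).indicator (fun _ => ENNReal.ofReal (Real.exp (|β| * 2))) φ :=
        lintegral_mono h
    _ = ENNReal.ofReal (Real.exp (|β| * 2)) * volume (Icc (-π) π) :=
        lintegral_indicator_const measurableSet_Icc _
    _ = _ := by rw [Real.volume_Icc, show π - -π = 2 * π by ring]

/-- The two variants of the weight differ only at `φ = −π`, a null set. -/
theorem u1AngleWeightIoc_ae_eq : u1AngleWeightIoc β =ᵐ[volume] u1AngleWeight β := by
  have hsub : {φ | u1AngleWeightIoc β φ ≠ u1AngleWeight β φ} ⊆ {-π} := by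
    intro φ hφ
    simp only [mem_setOf_eq, u1AngleWeightIoc, u1AngleWeight] at hφ
    by_contra hne
    apply hφ
    by_cases h1 : φ ∈ Ioc (-π) π
    · rw [indicator_of_mem h1, indicator_of_mem (Ioc_subset_Icc_self h1)]
    · have h2 : φ ∉ Icc (-π) π := fun h2 =>
        h1 ⟨lt_of_le_of_ne h2.1 (fun h => hne h.symm), h2.2⟩
      rw [indicator_of_notMem h1, indicator_of_notMem h2]
  exact measure_mono_null hsub (measure_singleton _)

/-- The sector weights are even in `k`: `g_V(−2πk) = g_V(2πk)`. -/
theorem u1SectorWeight_neg (V : ℕ) (k : ℤ) : u1SectorWeight β V (-k) = u1SectorWeight β V k := by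
  unfold u1SectorWeight
  rw [Int.cast_neg, mul_neg]
  exact convPow_neg (u1AngleWeight_neg β) _ _

/-- The sector weights are finite. -/
theorem u1SectorWeight_lt_top (V : ℕ) (k : ℤ) : u1SectorWeight β V k < ∞ := by
  refine lt_of_le_of_lt (convPow_le (measurable_u1AngleWeight β) (u1AngleWeight_le β) _ _) ?_
  refine ENNReal.mul_lt_top ENNReal.ofReal_lt_top (ENNReal.pow_lt_top ?_)
  exact lt_of_le_of_lt (lintegral_u1AngleWeight_le β)
    (ENNReal.mul_lt_top ENNReal.ofReal_lt_top ENNReal.ofReal_lt_top)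

/-- **The sector weight as an honest `(V−1)`-fold integral**:
`g_V(2πk) = ∫_{ℝ^{V−1}} p_β(2πk − Σ_i t_i) ∏_i p_β(t_i) dt` (unnormalised density at `2πk` of the
sum of `V` independent plaquette angles with density `∝ p_β`). -/
theorem u1SectorWeight_eq_lintegral (V : ℕ) (k : ℤ) :
    u1SectorWeight β V k = ∫⁻ t : Fin (V - 1) → ℝ,
      u1AngleWeight β (2 * π * k - ∑ i, t i) * ∏ i, u1AngleWeight β (t i) := by
  rw [lintegral_eq_convPow (measurable_u1AngleWeight β), Fintype.card_fin]
  rfl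

/-! ### 2. The topological charge as a sum over the sites -/

variable {L : ℕ} [NeZero L]

omit [NeZero L] in
/-- `![s, t] = s·e₀ + t·e₁` in `Site 2 L`. -/
theorem vec_two_eq_single_add_single (s t : ZMod L) :
    (![s, t] : Site 2 L) = (0 : Site 2 L) + Pi.single 0 s + Pi.single 1 t := by
  ext i
  fin_cases i <;> simp

/-- **`Q(U) = (2π)⁻¹ Σ_{x ∈ Λ} arg U_x`**: theory-2's `topCharge` (Lüscher's flux through the
`(0,1)`-plane) is the plain sum of the plaquette angles `arg U_p(x) ∈ (−π, π]` over all sites. -/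
theorem topCharge_eq_sum_arg (U : GaugeConfig 2 L Circle) :
    topCharge U = (∑ x : Site 2 L, Complex.arg ((plaquetteHolonomy U x 0 1 : Circle) : ℂ)) / (2 * π) := by
  unfold topCharge magneticFlux abelianFieldTensor
  congr 1
  rw [← (finTwoArrowEquiv (ZMod L)).symm.sum_comp, Fintype.sum_prod_type]
  simp only [finTwoArrowEquiv_symm_apply, vec_two_eq_single_add_single]

/-- `Q(U) = k` iff `Σ_x arg U_x = 2πk`. -/
theorem topCharge_eq_iff (U : GaugeConfig 2 L Circle) (k : ℤ) :
    topCharge U = k ↔ ∑ x : Site 2 L, Complex.arg ((plaquetteHolonomy U x 0 1 : Circle) : ℂ) = 2 * π * k := by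
  rw [topCharge_eq_sum_arg, div_eq_iff (by positivity)]
  constructor <;> intro h <;> rw [h] <;> ring

/-! ### 3. The sector integrand on plaquette fields -/

/-- The one-plaquette Wilson weight of `U(1)` as a function on the circle,
`w_β(g) = e^{−β(1 − Re tr g)}` (the factor of `weight_eq_prod_two` for `ρ = u1Rep`). -/
def u1CircleWeight (β : ℝ) (g : Circle) : ℝ≥0∞ :=
  ENNReal.ofReal (Real.exp (-(β * (((1 : ℕ) : ℝ) - (u1Rep g).trace.re))))

/-- In the angle: `w_β(e^{iφ}) = e^{−β(1 − cos φ)}`. -/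
theorem u1CircleWeight_exp (φ : ℝ) :
    u1CircleWeight β (Circle.exp φ) = ENNReal.ofReal (Real.exp (-(β * (1 - Real.cos φ)))) := by
  rw [u1CircleWeight, trace_u1Rep_re, Nat.cast_one, Theory2.Lattice.U1.re_coe_exp]

/-- `w_β` is measurable. -/
theorem measurable_u1CircleWeight : Measurable (u1CircleWeight β) :=
  measurable_oneWeight u1Rep continuous_u1Rep β

/-- The SECTOR INTEGRAND on plaquette fields `g : Λ → U(1)`:
`F_k(g) = 1{Σ_x arg g_x = 2πk} · ∏_x w_β(g_x)`. -/
def sectorIntegrand (β : ℝ) (k : ℤ) (g : Site 2 L → Circle) : ℝ≥0∞ :=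
  {g : Site 2 L → Circle | ∑ x, Complex.arg (g x : ℂ) = 2 * π * k}.indicator
    (fun g => ∏ x, u1CircleWeight β (g x)) g

/-- The sector integrand with the coordinate `x₀` ELIMINATED through the constraint
`g_{x₀} = (∏_{x ≠ x₀} g_x)⁻¹`: `F'_k(g) = F_k(g[x₀ ↦ (∏_{x ≠ x₀} g_x)⁻¹])`. -/
def sectorIntegrand' (β : ℝ) (k : ℤ) (x₀ : Site 2 L) (g : Site 2 L → Circle) : ℝ≥0∞ :=
  sectorIntegrand β k (Function.update g x₀ (∏ x ∈ Finset.univ.erase x₀, g x)⁻¹)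

/-- The constraint set `{Σ_x arg g_x = 2πk}` is measurable. -/
theorem measurableSet_sumArg (k : ℤ) :
    MeasurableSet {g : Site 2 L → Circle | ∑ x, Complex.arg (g x : ℂ) = 2 * π * k} := by
  have h : Measurable fun g : Site 2 L → Circle => ∑ x, Complex.arg (g x : ℂ) :=
    Finset.measurable_sum _ fun x _ =>
      Complex.measurable_arg.comp (continuous_subtype_val.comp (continuous_apply x)).measurable
  exact h (measurableSet_singleton _)

/-- `F_k` is measurable. -/
theorem measurable_sectorIntegrand (k : ℤ) : Measurable (sectorIntegrand (L := L) β k) := by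
  unfold sectorIntegrand
  exact (Finset.measurable_prod _ fun x _ =>
    (measurable_u1CircleWeight β).comp (measurable_pi_apply x)).indicator (measurableSet_sumArg k)

/-- The elimination map `g ↦ g[x₀ ↦ (∏_{x ≠ x₀} g_x)⁻¹]` is measurable. -/
theorem measurable_update_inv_prod (x₀ : Site 2 L) :
    Measurable fun g : Site 2 L → Circle =>
      Function.update g x₀ (∏ x ∈ Finset.univ.erase x₀, g x)⁻¹ := by
  refine measurable_pi_lambda _ fun x => ?_
  by_cases hx : x = x₀
  · subst hx
    simp only [Function.update_self]
    exact (Finset.measurable_prod _ fun x _ => measurable_pi_apply x).inv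
  · simp only [Function.update_of_ne hx]
    exact measurable_pi_apply x

/-- `F'_k` is measurable. -/
theorem measurable_sectorIntegrand' (k : ℤ) (x₀ : Site 2 L) :
    Measurable (sectorIntegrand' (L := L) β k x₀) :=
  (measurable_sectorIntegrand β k).comp (measurable_update_inv_prod x₀)

/-- `F'_k` does not depend on the coordinate `x₀`. -/
theorem sectorIntegrand'_update (k : ℤ) (x₀ : Site 2 L) (g : Site 2 L → Circle) (v : Circle) :
    sectorIntegrand' β k x₀ (Function.update g x₀ v) = sectorIntegrand' β k x₀ g := by
  unfold sectorIntegrand'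
  rw [Function.update_idem]
  congr 2
  refine congrArg _ (Finset.prod_congr rfl fun x hx => ?_)
  rw [Function.update_of_ne (Finset.ne_of_mem_erase hx)]

/-- On plaquette fields of LINK configurations the elimination is the identity
(`U_{x₀} = (∏_{x ≠ x₀} U_x)⁻¹`, abelian group): `F'_k(U_·) = F_k(U_·)`. -/
theorem sectorIntegrand'_plaquettes (k : ℤ) (x₀ : Site 2 L) (U : GaugeConfig 2 L Circle) :
    sectorIntegrand' β k x₀ (fun x => plaquetteHolonomy U x 0 1) =
      sectorIntegrand β k (fun x => plaquetteHolonomy U x 0 1) := by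
  unfold sectorIntegrand'
  rw [← plaquetteHolonomy_eq_inv_prod_erase U x₀, Function.update_eq_self]

/-- **The sector mass as a plaquette-field integral**:
`∫_{Q = k} e^{−βS} dHaar^{⊗E} = ∫ F_k(U_·) dHaar^{⊗E}(U)`. -/
theorem wilsonWeight_topCharge_eq_lintegral (k : ℤ) :
    wilsonWeight (d := 2) (L := L) u1Rep β {U | topCharge U = k} =
      ∫⁻ U, sectorIntegrand β k (fun x => plaquetteHolonomy U x 0 1)
        ∂(Measure.pi fun _ : Edge 2 L => haarProbability Circle) := by
  have hS : MeasurableSet {U : GaugeConfig 2 L Circle | topCharge U = k} :=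
    measurable_topCharge (measurableSet_singleton _)
  rw [wilsonWeight, withDensity_apply _ hS, ← lintegral_indicator hS]
  refine lintegral_congr fun U => ?_
  unfold sectorIntegrand
  by_cases h : ∑ x, Complex.arg ((plaquetteHolonomy U x 0 1 : Circle) : ℂ) = 2 * π * k
  · have h1 : U ∈ {U : GaugeConfig 2 L Circle | topCharge U = k} := (topCharge_eq_iff U k).2 h
    have h2 : (fun x => plaquetteHolonomy U x 0 1) ∈
        {g : Site 2 L → Circle | ∑ x, Complex.arg (g x : ℂ) = 2 * π * k} := h
    rw [indicator_of_mem h1, indicator_of_mem h2, weight_eq_prod_two u1Rep β U]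
    rfl
  · have h1 : U ∉ {U : GaugeConfig 2 L Circle | topCharge U = k} :=
      fun h' => h ((topCharge_eq_iff U k).1 h')
    have h2 : (fun x => plaquetteHolonomy U x 0 1) ∉
        {g : Site 2 L → Circle | ∑ x, Complex.arg (g x : ℂ) = 2 * π * k} := h
    rw [indicator_of_notMem h1, indicator_of_notMem h2]

/-- **Puncture**: `∫ F_k(U_·) dHaar^{⊗E}(U) = ∫_{U(1)^Λ} F'_k dHaar^{⊗Λ}` (theory-2's
independence of the plaquettes off `x₀`, `Scaling/PlaquetteMarginals2D.lean`). -/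
theorem lintegral_sectorIntegrand_eq_pi (hL : 2 ≤ L) (k : ℤ) (x₀ : Site 2 L) :
    ∫⁻ U, sectorIntegrand β k (fun x => plaquetteHolonomy U x 0 1)
        ∂(Measure.pi fun _ : Edge 2 L => haarProbability Circle) =
      ∫⁻ g, sectorIntegrand' β k x₀ g ∂(Measure.pi fun _ : Site 2 L => haarProbability Circle) := by
  rw [← lintegral_comp_plaquettes_eq_pi hL x₀ (measurable_sectorIntegrand' β k x₀)
    (sectorIntegrand'_update β k x₀)]
  simp_rw [sectorIntegrand'_plaquettes]

end Summit.Ventures.LatticeQCDFlow.Scoring
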